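import Summits.QuantumFields.BalabanUV.Beta.RowD1Telescoping

/-!
# `BalabanUV.Beta.RowD1TelescopingBounded` — binder row D1: **THE TELESCOPING CLAUSE THE ROW ACTUALLY NEEDS IS A BOUNDED CUMULATIVE READ-OUT
# DEFECT — AND, GIVEN `D1Rep`, IT IS EQUIVALENT TO THE ROW'S STATEMENT** («two out of three» among `D1Drift`, `D1Rep`, bounded read-out defect;
# generic over jet data, then at the literal of record `JsRowD1Pin hLc N` ∕ `JcPin hLc N`)
# (β sub-cell, BINDER-OWNERS row D1 OWNER, lineage an2 gen 22; sequel of `RowD1Telescoping` p232002)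

HONEST FRAMING (cell charter, verbatim): «discharging BetaPertH makes Balaban's UV stability UNCONDITIONAL — a real
constructive-QFT result; it is NOT the continuum limit and NOT the Clay problem.»
HONEST DEPENDENCY: continuum YM on T⁴ ⇐ BetaPertH ∧ nine spine estimates (0/9 proved); BetaPertH ⇐ (D1) ∧ (D4) ∧ CAP+tail;
G-an2-4 gates asym, D1 and NE2/3/4.
ABSOLUTE RULE (cell, verbatim): «No internally-minted statement may enter as a cited fact. Every hypothesis is either kernel-proved in this
package or a verbatim quotation of a PUBLISHED theorem with page reference. The manuscript(s) under audit are NOT citable for their own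
disputed steps — they are the thing under adjudication; programme-internal (2001/route/tribunal) claims are never citable.»
NOTHING below is cited: no `[cite: …]`, no `def`, no `Prop` fact.  Every declaration is [folklore]: triangle inequalities over the β-lead's
`ScalewiseVectorSeam.oneShotSide_drift` (the FREE-BUBBLE DRIFT, inputs = the two printed B5 Props BY NAME + labels + window data), an2/an4's
`OneStepKernelFamily.D1Rep`∕`D1Drift`, `Drift.OneLoopDrift`, the β-lead's `StepDriftWitness.secondMoment_step_sd` ∕ `absMoment₂_sd`, and §1 of `RowD1Telescoping`.

WHY (row-D1 owner, gen 22; census of the remaining clause).  `RowD1Telescoping` re-cut the row END to `D1Drift(JsRowD1Pin) ⟸ (SDF) ∧ D1Rep` with (SDF) the EXACT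
invisibility `∀ j ≥ 1, secondMoment (SD … j) μ ν = 0` of the full step defect.  Exactness is MORE than the row consumes: `D1Drift` and `D1Rep` are statements UP TO A
BOUNDED ERROR (`∃ A, ∀ k, |Σ_{j<k} β⁰_j − k·stepBal| ≤ A`; `∃ U, ∀ m ≥ 1, |secondMoment (TshotOf … m) μ ν − oneShotSide … (Lc^m)| ≤ U`), and the free bubble
`oneShotSide` itself drifts with slope `stepBal` (`oneShotSide_drift`).  Hence the telescoping input the row needs is ONLY that the READ-OUT DEFECT
`Σ_{j<m} secondMoment (TbalOf … j) μ ν − secondMoment (TshotOf … m) μ ν` stay BOUNDED in `m` — an `O(1)`-tolerant statement, insensitive to scale-independent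
scheme constants (e.g. which contour system the one-shot comparison family uses) — and this file proves that, given `D1Rep`, that boundedness is not only
sufficient but NECESSARY for `D1Drift`: among {`D1Drift`, `D1Rep`, bounded read-out defect} any two give the third.  By `secondMoment_step_JcPin` the read-out
defect of the literal IS minus the cumulative `(μ, ν)` second moment of the explicit step defects `SD … j`, `1 ≤ j < m` (§1, generic; §2, literal).

WHAT (all [folklore]; no hypothesis is a fact):
§1 GENERIC over `Js : ℕ → JetData 3 Lc`, `Jc : ∀ m, JetData 3 (Lc^m)`:
   `d1Drift_of_readoutBdd_D1Rep` (bounded read-out defect ∧ `D1Rep` ⟹ `D1Drift`), `readoutBdd_of_D1Drift_D1Rep`, `d1Rep_of_D1Drift_readoutBdd` (the other two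
   directions), `readoutDefect_eq_neg_sum_sd` (under (T0)/(T1) of the one-shot family and the base identity: `Σ_{j<m} β⁰_j − secondMoment (TshotOf … m) μ ν =
   −Σ_{j ∈ [1,m)} secondMoment (SD … j) μ ν`), `readoutBdd_iff_sdSumBdd`.
§2 THE LITERAL OF RECORD (`Odd Lc`, `2 ≤ N`; one-shot Ward data and base identity from `RowD1Telescoping` §1):
   **`d1Drift_JsRowD1Pin_of_sdSumBdd_D1Rep`**: `D1Drift Lc (JsRowD1Pin hLc N) Nc μ ν ⟸ (∃ U′, ∀ m ≥ 1, |Σ_{j ∈ [1,m)} secondMoment (SD Lc (JsRowD1Pin hLc N) (JcPin hLc N) j) μ ν| ≤ U′)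
   ∧ D1Rep Lc (JcPin hLc N) Nc μ ν a SL k` (+ printed B5 h12∕h126 BY NAME, window, `μ ≠ ν`, `Nc ≠ 0`, `2 ≤ Lc`);
   **`sdSumBdd_iff_D1Drift_of_D1Rep`**: GIVEN `D1Rep` (and the same standing data) the bounded cumulative defect is EQUIVALENT to `D1Drift` — the telescoping clause of
   row D1 in its weakest-and-necessary form; `sdSumBdd_of_sdInvisible` ((SDF) ⟹ it, with `U′ = 0`).
WHAT REMAINS OF ROW D1 AFTER THIS FILE, EXACTLY: (SDF-Σ) `∃ U′, ∀ m ≥ 1, |Σ_{1 ≤ j < m} secondMoment (SD Lc (JsRowD1Pin hLc N) (JcPin hLc N) j) μ ν| ≤ U′` — the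
cumulative one-loop scheme defect between «m block-`Lc` steps» and «one block-`Lc^m` step» of the typed literal stays bounded (LAYER 2 of P6 + P6c in `O(1)`-tolerant
form; NOT proved here) — and `D1Rep` (EXIT-A ⇐ G-an2-4).  Binders 2∕4; NOT D1, NOT `BetaPertH`, NOT continuum, NOT Clay.
Provenance: β sub-cell, unit beta-an2 gen 22, 2026-08-20 (v1 p232615; v1.1 = v1 + §3 APPEND-ONLY, every v1 declaration byte-identical; no existing file touched).  The auxiliary-family
socket (RULING (R24-2b) in SD-currency) is an3-g34's standalone `RowD1AuxiliaryExchange` (AN3-34B), NOT restated here.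
§3 (v1.1) THE BLOCK READ-OUT FORM (an1-g31's import-form reading `HOME/b2b-balaban-beta-an1-g31/xread/EngineTargetSDF.lean` 4247258bfab67f46, (E2)∕(E4) ADOPTED
   verbatim into this namespace at the author's invitation, journal l.19720; + the cumulative forms): with `c(n, j) := secondMoment (TbalOf n (JsRowD1Pin (Lc := n) _ N) j) μ ν`,
   `secondMoment_sd_JsRowD1Pin_eq_blockReadout` ((E4): `secondMoment (SD … j) μ ν = c(Lc^(j+1), 0) − c(Lc^j, 0) − c(Lc, j)`, `j ≥ 1` — NO transport weight, NO `dressedEntry`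
   left), `sdInvisible_JsRowD1Pin_iff_blockReadout` ((E2)), `sdSum_JsRowD1Pin_eq_blockReadout` (`Σ_{j ∈ [1,m)} secondMoment (SD … j) μ ν = c(Lc^m, 0) − Σ_{j<m} c(Lc, j)`, `m ≥ 1`),
   **`sdSumBdd_JsRowD1Pin_iff_blockReadoutBdd`** ((SDF-Σ) ⟺ «the first-step coefficient at block `Lc^m` equals the sum of the first m step coefficients at block Lc up to a
   bounded error»), `d1Drift_JsRowD1Pin_of_blockReadoutBdd_D1Rep` (the row END in that currency).  ENGINE «SDF-1» therefore needs only the three FIRST-STEP∕STEP kernels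
   `T_{Lc²,0}`, `T_{Lc,0}`, `T_{Lc,1}` and their `(μ,ν)` second moments (an1's consequence (i)).
-/

open Finset
open scoped BigOperators
open Literature.MathematicalPhysics.QuantumFieldTheory
open Literature.MathematicalPhysics.QuantumFieldTheory.Balaban1983to89
open Literature.MathematicalPhysics.QuantumFieldTheory.Balaban1983to89.Beta
open DecimatedMomentSummable (AbsMoment₂)
open OneStepResolventKernel (JetData)
open OneStepKernelFamily (TbalOf TshotOf D1Rep D1Drift)
open StepDriftWitness (SD SDInvisible secondMoment_step_sd absMoment₂_sd)
open ScalewiseVectorSeam (oneShotSide oneShotSide_drift)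
open Drift (OneLoopDrift)
open B12Beta (secondMoment)
open Literature.MathematicalPhysics.QuantumFieldTheory.Balaban1983to89.Beta.VectorTailsLoc (fam kfam)
open Literature.MathematicalPhysics.QuantumFieldTheory.Balaban1983to89.Beta.VectorLegVolumeAdapter (MvE)
open Summit.QuantumFields.BalabanUV.Beta.RowD1JointEnd (JsRowD1Pin)
open Summit.QuantumFields.BalabanUV.Beta.D1BFx.FirstStepPinned (JcPin)
open Summit.QuantumFields.BalabanUV.Beta.RowD1Telescoping (shotT0_JcPin shotT1_JcPin hbase_JcPin)

namespace Summit.QuantumFields.BalabanUV.Beta.RowD1TelescopingBounded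

noncomputable section

variable {Lc : ℕ} [NeZero Lc] {L : Type*}

/-! ## §1 Generic: two out of three among `D1Drift`, `D1Rep`, bounded read-out defect -/

/-- [folklore] **BOUNDED READ-OUT DEFECT ∧ `D1Rep` ⟹ `D1Drift`** (generic jet data; + the free-bubble drift's inputs: printed B5 h12∕h126 BY NAME, labels,
window data, `μ ≠ ν`, `N ≠ 0`, `2 ≤ Lc`).  Triangle inequality through `oneShotSide_drift`; NO Ward data, NO `D1Tel`, NO exact telescoping. -/
theorem d1Drift_of_readoutBdd_D1Rep (a : ℝ) (ha : 0 < a)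
    (h12 : B5.Prop12Printed (fam (fun i : ℕ+ × ℕ => ((i.1 : ℕ+) : ℕ)) (fun i => i.1.pos) MvE a ha))
    (h126 : B5.Kernel126_127Printed (kfam (fun i : ℕ+ × ℕ => ((i.1 : ℕ+) : ℕ)) MvE))
    {SL : Finset L} (hSL : SL.Nonempty) (k : L → Fin 4) {μ ν : Fin 4} (hμν : μ ≠ ν) {N : ℝ} (hN : N ≠ 0) (hL : 2 ≤ Lc)
    (Js : ℕ → JetData 3 Lc) (Jc : ∀ m : ℕ, JetData 3 (Lc ^ m))
    (hbdd : ∃ U' : ℝ, ∀ m : ℕ, 1 ≤ m →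
      |∑ j ∈ range m, secondMoment (TbalOf Lc Js j) μ ν - secondMoment (TshotOf Lc Jc m) μ ν| ≤ U')
    {cc : ℝ} {M : ℕ → ℕ} (hc : 1 ≤ cc) (hM : ∀ L : ℕ, 2 ≤ L → 1 ≤ M L ∧ (L : ℝ) ≤ cc * M L) (hML : ∀ L : ℕ, 2 ≤ L → M L ≤ L)
    (hrep : D1Rep Lc Jc N μ ν a SL k) : D1Drift Lc Js N μ ν := by
  obtain ⟨U', hU'⟩ := hbdd
  obtain ⟨U, hU⟩ := hrep
  obtain ⟨A, hA⟩ := oneShotSide_drift a ha h12 h126 hSL k hμν hN hL hc hM hML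
  refine ⟨U' + U + A + |oneShotSide SL μ ν N a k (Lc ^ 0)|, fun n => ?_⟩
  have hA0 : 0 ≤ A := le_trans (abs_nonneg _) (hA 0)
  rcases Nat.eq_zero_or_pos n with rfl | hn
  · simp only [Finset.range_zero, Finset.sum_empty, Nat.cast_zero, mul_zero, sub_zero, abs_zero]
    have h1 : 0 ≤ U' := le_trans (abs_nonneg _) (hU' 1 le_rfl)
    have h2 : 0 ≤ U := le_trans (abs_nonneg _) (hU 1 le_rfl)
    positivity
  · have h1 := hU' n hn
    have h2 := hU n hn
    have h3 := hA n
    have e : ∑ j ∈ range n, secondMoment (TbalOf Lc Js j) μ ν - B12Normalization.stepBal N Lc * n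
        = (∑ j ∈ range n, secondMoment (TbalOf Lc Js j) μ ν - secondMoment (TshotOf Lc Jc n) μ ν)
          + (secondMoment (TshotOf Lc Jc n) μ ν - oneShotSide SL μ ν N a k (Lc ^ n))
          + (oneShotSide SL μ ν N a k (Lc ^ n) - oneShotSide SL μ ν N a k (Lc ^ 0) - B12Normalization.stepBal N Lc * n)
          + oneShotSide SL μ ν N a k (Lc ^ 0) := by ring
    rw [e]
    refine (abs_add_le _ _).trans (add_le_add ((abs_add_le _ _).trans (add_le_add ((abs_add_le _ _).trans (add_le_add h1 h2)) h3)) le_rfl)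

/-- [folklore] **`D1Drift` ∧ `D1Rep` ⟹ BOUNDED READ-OUT DEFECT** (the converse bookkeeping; same standing data). -/
theorem readoutBdd_of_D1Drift_D1Rep (a : ℝ) (ha : 0 < a)
    (h12 : B5.Prop12Printed (fam (fun i : ℕ+ × ℕ => ((i.1 : ℕ+) : ℕ)) (fun i => i.1.pos) MvE a ha))
    (h126 : B5.Kernel126_127Printed (kfam (fun i : ℕ+ × ℕ => ((i.1 : ℕ+) : ℕ)) MvE))
    {SL : Finset L} (hSL : SL.Nonempty) (k : L → Fin 4) {μ ν : Fin 4} (hμν : μ ≠ ν) {N : ℝ} (hN : N ≠ 0) (hL : 2 ≤ Lc)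
    (Js : ℕ → JetData 3 Lc) (Jc : ∀ m : ℕ, JetData 3 (Lc ^ m))
    {cc : ℝ} {M : ℕ → ℕ} (hc : 1 ≤ cc) (hM : ∀ L : ℕ, 2 ≤ L → 1 ≤ M L ∧ (L : ℝ) ≤ cc * M L) (hML : ∀ L : ℕ, 2 ≤ L → M L ≤ L)
    (hD : D1Drift Lc Js N μ ν) (hrep : D1Rep Lc Jc N μ ν a SL k) :
    ∃ U' : ℝ, ∀ m : ℕ, 1 ≤ m →
      |∑ j ∈ range m, secondMoment (TbalOf Lc Js j) μ ν - secondMoment (TshotOf Lc Jc m) μ ν| ≤ U' := by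
  obtain ⟨A', hA'⟩ := hD
  obtain ⟨U, hU⟩ := hrep
  obtain ⟨A, hA⟩ := oneShotSide_drift a ha h12 h126 hSL k hμν hN hL hc hM hML
  refine ⟨A' + U + A + |oneShotSide SL μ ν N a k (Lc ^ 0)|, fun n hn => ?_⟩
  have h1 := hA' n
  have h2 := hU n hn
  have h3 := hA n
  have e : ∑ j ∈ range n, secondMoment (TbalOf Lc Js j) μ ν - secondMoment (TshotOf Lc Jc n) μ ν
      = (∑ j ∈ range n, secondMoment (TbalOf Lc Js j) μ ν - B12Normalization.stepBal N Lc * n)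
        - (secondMoment (TshotOf Lc Jc n) μ ν - oneShotSide SL μ ν N a k (Lc ^ n))
        - (oneShotSide SL μ ν N a k (Lc ^ n) - oneShotSide SL μ ν N a k (Lc ^ 0) - B12Normalization.stepBal N Lc * n)
        - oneShotSide SL μ ν N a k (Lc ^ 0) := by
    ring
  rw [e]
  refine (abs_sub _ _).trans (add_le_add ((abs_sub _ _).trans (add_le_add ((abs_sub _ _).trans (add_le_add ?_ h2)) h3)) le_rfl)
  exact h1

/-- [folklore] **`D1Drift` ∧ BOUNDED READ-OUT DEFECT ⟹ `D1Rep`** (the third direction; same standing data). -/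
theorem d1Rep_of_D1Drift_readoutBdd (a : ℝ) (ha : 0 < a)
    (h12 : B5.Prop12Printed (fam (fun i : ℕ+ × ℕ => ((i.1 : ℕ+) : ℕ)) (fun i => i.1.pos) MvE a ha))
    (h126 : B5.Kernel126_127Printed (kfam (fun i : ℕ+ × ℕ => ((i.1 : ℕ+) : ℕ)) MvE))
    {SL : Finset L} (hSL : SL.Nonempty) (k : L → Fin 4) {μ ν : Fin 4} (hμν : μ ≠ ν) {N : ℝ} (hN : N ≠ 0) (hL : 2 ≤ Lc)
    (Js : ℕ → JetData 3 Lc) (Jc : ∀ m : ℕ, JetData 3 (Lc ^ m))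
    {cc : ℝ} {M : ℕ → ℕ} (hc : 1 ≤ cc) (hM : ∀ L : ℕ, 2 ≤ L → 1 ≤ M L ∧ (L : ℝ) ≤ cc * M L) (hML : ∀ L : ℕ, 2 ≤ L → M L ≤ L)
    (hD : D1Drift Lc Js N μ ν)
    (hbdd : ∃ U' : ℝ, ∀ m : ℕ, 1 ≤ m →
      |∑ j ∈ range m, secondMoment (TbalOf Lc Js j) μ ν - secondMoment (TshotOf Lc Jc m) μ ν| ≤ U') :
    D1Rep Lc Jc N μ ν a SL k := by
  obtain ⟨A', hA'⟩ := hD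
  obtain ⟨U', hU'⟩ := hbdd
  obtain ⟨A, hA⟩ := oneShotSide_drift a ha h12 h126 hSL k hμν hN hL hc hM hML
  refine ⟨A' + U' + A + |oneShotSide SL μ ν N a k (Lc ^ 0)|, fun n hn => ?_⟩
  have h1 := hA' n
  have h2 := hU' n hn
  have h3 := hA n
  have e : secondMoment (TshotOf Lc Jc n) μ ν - oneShotSide SL μ ν N a k (Lc ^ n)
      = (∑ j ∈ range n, secondMoment (TbalOf Lc Js j) μ ν - B12Normalization.stepBal N Lc * n)
        - (∑ j ∈ range n, secondMoment (TbalOf Lc Js j) μ ν - secondMoment (TshotOf Lc Jc n) μ ν)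
        - (oneShotSide SL μ ν N a k (Lc ^ n) - oneShotSide SL μ ν N a k (Lc ^ 0) - B12Normalization.stepBal N Lc * n)
        - oneShotSide SL μ ν N a k (Lc ^ 0) := by
    ring
  rw [e]
  refine (abs_sub _ _).trans (add_le_add ((abs_sub _ _).trans (add_le_add ((abs_sub _ _).trans (add_le_add ?_ h2)) h3)) le_rfl)
  exact h1

/-- [folklore] **THE READ-OUT DEFECT IS MINUS THE CUMULATIVE SECOND MOMENT OF THE STEP DEFECTS** (generic; (T0)/(T1) of the one-shot family `m ≥ 1`
and the base identity; (SDA) automatic): for every `m ≥ 1`,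
`Σ_{j<m} secondMoment (TbalOf Lc Js j) μ ν − secondMoment (TshotOf Lc Jc m) μ ν = −Σ_{j ∈ [1,m)} secondMoment (SD Lc Js Jc j) μ ν`
(the lead's `secondMoment_step_sd`, summed). -/
theorem readoutDefect_eq_neg_sum_sd (Js : ℕ → JetData 3 Lc) (Jc : ∀ m : ℕ, JetData 3 (Lc ^ m)) (μ ν : Fin 4)
    (h𝒯0 : ∀ m, 1 ≤ m → ∀ c e : Fin 4, HasSum (TshotOf Lc Jc m c e) 0)
    (h𝒯1 : ∀ m, 1 ≤ m → ∀ c e ρ : Fin 4, HasSum (fun t : Fin 4 → ℤ => t ρ • TshotOf Lc Jc m c e t) 0)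
    (hbase : TshotOf Lc Jc 1 = TbalOf Lc Js 0) :
    ∀ m : ℕ, 1 ≤ m → ∑ j ∈ range m, secondMoment (TbalOf Lc Js j) μ ν - secondMoment (TshotOf Lc Jc m) μ ν
      = -∑ j ∈ Ico 1 m, secondMoment (SD Lc Js Jc j) μ ν := by
  have hstep := secondMoment_step_sd Js Jc μ ν h𝒯0 h𝒯1 (fun j _ c e => absMoment₂_sd Js Jc j c e)
  intro m hm
  induction m, hm using Nat.le_induction with
  | base =>
      rw [Finset.sum_range_one, hbase, Finset.Ico_self, Finset.sum_empty, neg_zero, sub_self]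
  | succ m hm ih =>
      rw [Finset.sum_range_succ, hstep m hm, Finset.sum_Ico_succ_top hm, neg_add, ← ih]
      ring

/-- [folklore] Hence the read-out defect is bounded IFF the cumulative step-defect second moment is (generic; same data). -/
theorem readoutBdd_iff_sdSumBdd (Js : ℕ → JetData 3 Lc) (Jc : ∀ m : ℕ, JetData 3 (Lc ^ m)) (μ ν : Fin 4)
    (h𝒯0 : ∀ m, 1 ≤ m → ∀ c e : Fin 4, HasSum (TshotOf Lc Jc m c e) 0)
    (h𝒯1 : ∀ m, 1 ≤ m → ∀ c e ρ : Fin 4, HasSum (fun t : Fin 4 → ℤ => t ρ • TshotOf Lc Jc m c e t) 0)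
    (hbase : TshotOf Lc Jc 1 = TbalOf Lc Js 0) :
    (∃ U' : ℝ, ∀ m : ℕ, 1 ≤ m →
        |∑ j ∈ range m, secondMoment (TbalOf Lc Js j) μ ν - secondMoment (TshotOf Lc Jc m) μ ν| ≤ U') ↔
      ∃ U' : ℝ, ∀ m : ℕ, 1 ≤ m → |∑ j ∈ Ico 1 m, secondMoment (SD Lc Js Jc j) μ ν| ≤ U' := by
  have h := readoutDefect_eq_neg_sum_sd Js Jc μ ν h𝒯0 h𝒯1 hbase
  constructor
  · rintro ⟨U', hU'⟩
    exact ⟨U', fun m hm => by rw [← abs_neg, ← h m hm]; exact hU' m hm⟩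
  · rintro ⟨U', hU'⟩
    exact ⟨U', fun m hm => by rw [h m hm, abs_neg]; exact hU' m hm⟩

/-! ## §2 The literal of record -/

/-- [folklore] **(SDF) ⟹ (SDF-Σ) with `U′ = 0`** for the literal of record (and for any jet data): exact invisibility gives a zero cumulative defect. -/
theorem sdSumBdd_of_sdInvisible (hLc : Odd Lc) (N : ℕ) {μ ν : Fin 4}
    (hSF : SDInvisible Lc (JsRowD1Pin hLc N) (JcPin hLc N) μ ν) :
    ∃ U' : ℝ, ∀ m : ℕ, 1 ≤ m → |∑ j ∈ Ico 1 m, secondMoment (SD Lc (JsRowD1Pin hLc N) (JcPin hLc N) j) μ ν| ≤ U' := by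
  refine ⟨0, fun m _ => ?_⟩
  rw [Finset.sum_eq_zero fun j hj => hSF j (Finset.mem_Ico.1 hj).1, abs_zero]

/-- [folklore] **BINDER ROW D1 FOR THE LITERAL OF RECORD, `O(1)`-TOLERANT CUT: `D1Drift Lc (JsRowD1Pin hLc N) Nc μ ν` ⟸ (SDF-Σ) ∧ `D1Rep`** (+ printed B5
facts BY NAME, window data, `μ ≠ ν`, `Nc ≠ 0`, `2 ≤ Lc`, `2 ≤ N`) — (SDF-Σ) = the cumulative `(μ, ν)` second moment of the explicit step defects
`SD Lc (JsRowD1Pin hLc N) (JcPin hLc N) j`, `1 ≤ j < m`, stays BOUNDED in `m`.  One-shot Ward data and base identity from `RowD1Telescoping` §1; the rest is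
§1's triangle inequality.  CONDITIONAL on (SDF-Σ) (LAYER 2 of P6 + P6c in `O(1)`-tolerant form, NOT proved here) and `D1Rep` (EXIT-A); `Nc` free ((P6)).
Binders 2∕4; NOT D1, NOT `BetaPertH`, NOT continuum, NOT Clay. -/
theorem d1Drift_JsRowD1Pin_of_sdSumBdd_D1Rep (hLc : Odd Lc) (hL2 : 2 ≤ Lc) {N : ℕ} (hN : 2 ≤ N)
    (a : ℝ) (ha : 0 < a)
    (h12 : B5.Prop12Printed (fam (fun i : ℕ+ × ℕ => ((i.1 : ℕ+) : ℕ)) (fun i => i.1.pos) MvE a ha))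
    (h126 : B5.Kernel126_127Printed (kfam (fun i : ℕ+ × ℕ => ((i.1 : ℕ+) : ℕ)) MvE))
    {SL : Finset L} (hSL : SL.Nonempty) (k : L → Fin 4) {μ ν : Fin 4} (hμν : μ ≠ ν) {Nc : ℝ} (hNc : Nc ≠ 0)
    (hSB : ∃ U' : ℝ, ∀ m : ℕ, 1 ≤ m → |∑ j ∈ Ico 1 m, secondMoment (SD Lc (JsRowD1Pin hLc N) (JcPin hLc N) j) μ ν| ≤ U')
    {cc : ℝ} {M : ℕ → ℕ} (hc : 1 ≤ cc) (hMw : ∀ L : ℕ, 2 ≤ L → 1 ≤ M L ∧ (L : ℝ) ≤ cc * M L) (hML : ∀ L : ℕ, 2 ≤ L → M L ≤ L)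
    (hrep : D1Rep Lc (JcPin hLc N) Nc μ ν a SL k) :
    D1Drift Lc (JsRowD1Pin hLc N) Nc μ ν :=
  d1Drift_of_readoutBdd_D1Rep a ha h12 h126 hSL k hμν hNc hL2 (JsRowD1Pin hLc N) (JcPin hLc N)
    ((readoutBdd_iff_sdSumBdd (JsRowD1Pin hLc N) (JcPin hLc N) μ ν (shotT0_JcPin hLc hN) (shotT1_JcPin hLc hN) (hbase_JcPin hLc N)).2 hSB)
    hc hMw hML hrep

/-- [folklore] **GIVEN `D1Rep`, (SDF-Σ) IS EQUIVALENT TO THE ROW'S STATEMENT** for the literal of record (same standing data): the telescoping clause of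
binder row D1 in its weakest-and-necessary form.  Neither side is proved here. -/
theorem sdSumBdd_iff_D1Drift_of_D1Rep (hLc : Odd Lc) (hL2 : 2 ≤ Lc) {N : ℕ} (hN : 2 ≤ N)
    (a : ℝ) (ha : 0 < a)
    (h12 : B5.Prop12Printed (fam (fun i : ℕ+ × ℕ => ((i.1 : ℕ+) : ℕ)) (fun i => i.1.pos) MvE a ha))
    (h126 : B5.Kernel126_127Printed (kfam (fun i : ℕ+ × ℕ => ((i.1 : ℕ+) : ℕ)) MvE))
    {SL : Finset L} (hSL : SL.Nonempty) (k : L → Fin 4) {μ ν : Fin 4} (hμν : μ ≠ ν) {Nc : ℝ} (hNc : Nc ≠ 0)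
    {cc : ℝ} {M : ℕ → ℕ} (hc : 1 ≤ cc) (hMw : ∀ L : ℕ, 2 ≤ L → 1 ≤ M L ∧ (L : ℝ) ≤ cc * M L) (hML : ∀ L : ℕ, 2 ≤ L → M L ≤ L)
    (hrep : D1Rep Lc (JcPin hLc N) Nc μ ν a SL k) :
    (∃ U' : ℝ, ∀ m : ℕ, 1 ≤ m → |∑ j ∈ Ico 1 m, secondMoment (SD Lc (JsRowD1Pin hLc N) (JcPin hLc N) j) μ ν| ≤ U') ↔
      D1Drift Lc (JsRowD1Pin hLc N) Nc μ ν := by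
  refine ⟨fun h => d1Drift_JsRowD1Pin_of_sdSumBdd_D1Rep hLc hL2 hN a ha h12 h126 hSL k hμν hNc h hc hMw hML hrep, fun hD => ?_⟩
  exact (readoutBdd_iff_sdSumBdd (JsRowD1Pin hLc N) (JcPin hLc N) μ ν (shotT0_JcPin hLc hN) (shotT1_JcPin hLc hN) (hbase_JcPin hLc N)).1
    (readoutBdd_of_D1Drift_D1Rep a ha h12 h126 hSL k hμν hNc hL2 (JsRowD1Pin hLc N) (JcPin hLc N) hc hMw hML hD hrep)

/-- [folklore] **AND GIVEN `D1Drift`, (SDF-Σ) IS EQUIVALENT TO `D1Rep`** for the literal of record — so the two open clauses of row D1 are tied: whichever road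
closes `D1Drift` first (e.g. road A2's fixed-point route) turns the other clause into a consequence of (SDF-Σ), and conversely. -/
theorem d1Rep_JcPin_of_D1Drift_sdSumBdd (hLc : Odd Lc) (hL2 : 2 ≤ Lc) {N : ℕ} (hN : 2 ≤ N)
    (a : ℝ) (ha : 0 < a)
    (h12 : B5.Prop12Printed (fam (fun i : ℕ+ × ℕ => ((i.1 : ℕ+) : ℕ)) (fun i => i.1.pos) MvE a ha))
    (h126 : B5.Kernel126_127Printed (kfam (fun i : ℕ+ × ℕ => ((i.1 : ℕ+) : ℕ)) MvE))
    {SL : Finset L} (hSL : SL.Nonempty) (k : L → Fin 4) {μ ν : Fin 4} (hμν : μ ≠ ν) {Nc : ℝ} (hNc : Nc ≠ 0)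
    {cc : ℝ} {M : ℕ → ℕ} (hc : 1 ≤ cc) (hMw : ∀ L : ℕ, 2 ≤ L → 1 ≤ M L ∧ (L : ℝ) ≤ cc * M L) (hML : ∀ L : ℕ, 2 ≤ L → M L ≤ L)
    (hD : D1Drift Lc (JsRowD1Pin hLc N) Nc μ ν)
    (hSB : ∃ U' : ℝ, ∀ m : ℕ, 1 ≤ m → |∑ j ∈ Ico 1 m, secondMoment (SD Lc (JsRowD1Pin hLc N) (JcPin hLc N) j) μ ν| ≤ U') :
    D1Rep Lc (JcPin hLc N) Nc μ ν a SL k :=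
  d1Rep_of_D1Drift_readoutBdd a ha h12 h126 hSL k hμν hNc hL2 (JsRowD1Pin hLc N) (JcPin hLc N) hc hMw hML hD
    ((readoutBdd_iff_sdSumBdd (JsRowD1Pin hLc N) (JcPin hLc N) μ ν (shotT0_JcPin hLc hN) (shotT1_JcPin hLc hN) (hbase_JcPin hLc N)).2 hSB)


/-! ## §3 (v1.1) The block read-out form: only first-step ∕ step coefficients, no transport (an1-g31's reading (E2)∕(E4), adopted; + cumulative forms) -/

/-- [folklore] **(E4) THE STEP DEFECT'S SECOND MOMENT IN BLOCK READ-OUT FORM** (an1-g31, adopted verbatim): for `j ≥ 1` and every channel,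
`secondMoment (SD Lc (JsRowD1Pin hLc N) (JcPin hLc N) j) μ ν = c(Lc^(j+1), 0) − c(Lc^j, 0) − c(Lc, j)` with `c(n, j) := secondMoment (TbalOf n (JsRowD1Pin (Lc := n) _ N) j) μ ν` —
the transport weight `wStep`, `dressedEntry` and `TshotOf` have dropped out (`secondMoment_step_JcPin` + `TshotOf_JcPin_eq_TbalOf_zero`, rearranged). -/
theorem secondMoment_sd_JsRowD1Pin_eq_blockReadout (hLc : Odd Lc) {N : ℕ} (hN : 2 ≤ N) (μ ν : Fin 4) (j : ℕ) (hj : 1 ≤ j) :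
    secondMoment (SD Lc (JsRowD1Pin hLc N) (JcPin hLc N) j) μ ν =
      secondMoment (TbalOf (Lc ^ (j + 1)) (JsRowD1Pin (Lc := Lc ^ (j + 1)) hLc.pow N) 0) μ ν
        - secondMoment (TbalOf (Lc ^ j) (JsRowD1Pin (Lc := Lc ^ j) hLc.pow N) 0) μ ν
        - secondMoment (TbalOf Lc (JsRowD1Pin hLc N) j) μ ν := by
  have h := RowD1Telescoping.secondMoment_step_JcPin hLc hN μ ν j hj
  rw [D1BFx.FirstStepPinned.TshotOf_JcPin_eq_TbalOf_zero, D1BFx.FirstStepPinned.TshotOf_JcPin_eq_TbalOf_zero] at h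
  linear_combination -h

/-- [folklore] **(E2) (SDF) FOR THE LITERAL OF RECORD = BLOCK READ-OUT ADDITIVITY OF FIRST STEPS AT EVERY STEP** (an1-g31, adopted verbatim):
`SDInvisible … μ ν ↔ ∀ j ≥ 1, c(Lc^(j+1), 0) = c(Lc^j, 0) + c(Lc, j)`. -/
theorem sdInvisible_JsRowD1Pin_iff_blockReadout (hLc : Odd Lc) {N : ℕ} (hN : 2 ≤ N) (μ ν : Fin 4) :
    SDInvisible Lc (JsRowD1Pin hLc N) (JcPin hLc N) μ ν ↔
      ∀ j : ℕ, 1 ≤ j →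
        secondMoment (TbalOf (Lc ^ (j + 1)) (JsRowD1Pin (Lc := Lc ^ (j + 1)) hLc.pow N) 0) μ ν
          = secondMoment (TbalOf (Lc ^ j) (JsRowD1Pin (Lc := Lc ^ j) hLc.pow N) 0) μ ν
              + secondMoment (TbalOf Lc (JsRowD1Pin hLc N) j) μ ν := by
  refine forall₂_congr fun j hj => ?_
  rw [secondMoment_sd_JsRowD1Pin_eq_blockReadout hLc hN μ ν j hj, sub_sub, sub_eq_zero]

/-- [folklore] **THE CUMULATIVE STEP DEFECT IN BLOCK READ-OUT FORM**: for `m ≥ 1`,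
`Σ_{j ∈ [1,m)} secondMoment (SD … j) μ ν = c(Lc^m, 0) − Σ_{j<m} c(Lc, j)` — the first-step coefficient at block `Lc^m` minus the sum of the first `m` step
coefficients at block `Lc` (`readoutDefect_eq_neg_sum_sd` at the literal, the one-shot read as the first step at block `Lc^m`). -/
theorem sdSum_JsRowD1Pin_eq_blockReadout (hLc : Odd Lc) {N : ℕ} (hN : 2 ≤ N) (μ ν : Fin 4) :
    ∀ m : ℕ, 1 ≤ m → ∑ j ∈ Ico 1 m, secondMoment (SD Lc (JsRowD1Pin hLc N) (JcPin hLc N) j) μ ν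
      = secondMoment (TbalOf (Lc ^ m) (JsRowD1Pin (Lc := Lc ^ m) hLc.pow N) 0) μ ν
          - ∑ j ∈ range m, secondMoment (TbalOf Lc (JsRowD1Pin hLc N) j) μ ν := by
  intro m hm
  have h := readoutDefect_eq_neg_sum_sd (JsRowD1Pin hLc N) (JcPin hLc N) μ ν (shotT0_JcPin hLc hN) (shotT1_JcPin hLc hN)
    (hbase_JcPin hLc N) m hm
  rw [D1BFx.FirstStepPinned.TshotOf_JcPin_eq_TbalOf_zero] at h
  linear_combination h

/-- [folklore] **(SDF-Σ) IN BLOCK READ-OUT FORM**: the cumulative step defect is bounded IFF «the first-step `(μ,ν)` coefficient at block `Lc^m` equals the sum of the first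
`m` step coefficients at block `Lc` up to a bounded error» — `∃ U′, ∀ m ≥ 1, |c(Lc^m, 0) − Σ_{j<m} c(Lc, j)| ≤ U′`.  Neither side is proved here. -/
theorem sdSumBdd_JsRowD1Pin_iff_blockReadoutBdd (hLc : Odd Lc) {N : ℕ} (hN : 2 ≤ N) (μ ν : Fin 4) :
    (∃ U' : ℝ, ∀ m : ℕ, 1 ≤ m → |∑ j ∈ Ico 1 m, secondMoment (SD Lc (JsRowD1Pin hLc N) (JcPin hLc N) j) μ ν| ≤ U') ↔
      ∃ U' : ℝ, ∀ m : ℕ, 1 ≤ m →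
        |secondMoment (TbalOf (Lc ^ m) (JsRowD1Pin (Lc := Lc ^ m) hLc.pow N) 0) μ ν
          - ∑ j ∈ range m, secondMoment (TbalOf Lc (JsRowD1Pin hLc N) j) μ ν| ≤ U' := by
  have h := sdSum_JsRowD1Pin_eq_blockReadout hLc hN μ ν
  constructor
  · rintro ⟨U', hU'⟩
    exact ⟨U', fun m hm => by rw [← h m hm]; exact hU' m hm⟩
  · rintro ⟨U', hU'⟩
    exact ⟨U', fun m hm => by rw [h m hm]; exact hU' m hm⟩

/-- [folklore] **THE ROW END IN BLOCK READ-OUT CURRENCY**: `D1Drift Lc (JsRowD1Pin hLc N) Nc μ ν` ⟸ «first step at block `Lc^m` = sum of the first `m` steps at block `Lc`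
up to `O(1)` in the `(μ,ν)` second moment» ∧ `D1Rep Lc (JcPin hLc N) Nc μ ν a SL k` (+ printed B5 facts BY NAME, window, `μ ≠ ν`, `Nc ≠ 0`, `2 ≤ Lc`, `2 ≤ N`).  CONDITIONAL on both;
binders 2∕4; NOT D1, NOT `BetaPertH`, NOT continuum, NOT Clay. -/
theorem d1Drift_JsRowD1Pin_of_blockReadoutBdd_D1Rep (hLc : Odd Lc) (hL2 : 2 ≤ Lc) {N : ℕ} (hN : 2 ≤ N)
    (a : ℝ) (ha : 0 < a)
    (h12 : B5.Prop12Printed (fam (fun i : ℕ+ × ℕ => ((i.1 : ℕ+) : ℕ)) (fun i => i.1.pos) MvE a ha))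
    (h126 : B5.Kernel126_127Printed (kfam (fun i : ℕ+ × ℕ => ((i.1 : ℕ+) : ℕ)) MvE))
    {SL : Finset L} (hSL : SL.Nonempty) (k : L → Fin 4) {μ ν : Fin 4} (hμν : μ ≠ ν) {Nc : ℝ} (hNc : Nc ≠ 0)
    (hblk : ∃ U' : ℝ, ∀ m : ℕ, 1 ≤ m →
        |secondMoment (TbalOf (Lc ^ m) (JsRowD1Pin (Lc := Lc ^ m) hLc.pow N) 0) μ ν
          - ∑ j ∈ range m, secondMoment (TbalOf Lc (JsRowD1Pin hLc N) j) μ ν| ≤ U')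
    {cc : ℝ} {M : ℕ → ℕ} (hc : 1 ≤ cc) (hMw : ∀ L : ℕ, 2 ≤ L → 1 ≤ M L ∧ (L : ℝ) ≤ cc * M L) (hML : ∀ L : ℕ, 2 ≤ L → M L ≤ L)
    (hrep : D1Rep Lc (JcPin hLc N) Nc μ ν a SL k) :
    D1Drift Lc (JsRowD1Pin hLc N) Nc μ ν :=
  d1Drift_JsRowD1Pin_of_sdSumBdd_D1Rep hLc hL2 hN a ha h12 h126 hSL k hμν hNc
    ((sdSumBdd_JsRowD1Pin_iff_blockReadoutBdd hLc hN μ ν).2 hblk) hc hMw hML hrep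

end

end Summit.QuantumFields.BalabanUV.Beta.RowD1TelescopingBounded
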